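import Mathlib
import Summits.Ventures.FusionMHD.Models.RwmFRS1Eq
import Summits.Ventures.FusionMHD.Models.RwmFRS1Res21
import Literature.MathematicalPhysics.MHD.NewcombResonantEtaCertificate
import HarnessLib

/-!
# «F3.σ-NEWCOMB-RES21-FRS1-EQ-η», part 1/3 (BASE): profile transfers, Newcomb's `g` with the pressure term, the inner
# supersolution `w₁ = r`, the factorisation `f = (r_s − r)²·φ`, `φ′`, and the η-brackets with `ν = −1/10`, `P ≡ 1`

See `RwmFRS1EqRes21Eta.lean` (part 3/3) for the statement, the THREE COLUMNS and the citations; this file is split off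
only for the 400-line rule.  MODEL M_RWM,eq = `RwmFRS1.Eq.Peq` BY NAME (force-balanced FRS1 screw pinch, finite β);
helicity `(m, k) = (2, −1/5)`, resonance `r_s = √(3/7)` (`Res21.rs`).  gridfusion-lit-4 (g13), 2026-08-28.
0 kit, 0 named facts, no `decide`. [instance data]
[cite: Freidberg2014, §11.5.1 eqs. (11.89)–(11.90), §11.5.3 eqs. (11.105)–(11.116)]
-/

noncomputable section

open Real Set
open Literature.MathematicalPhysics.MHD Literature.MathematicalPhysics.MHD.ScrewPinch
open Literature.Analysis.ODE.ResonantPower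
open Literature.Analysis.ValidatedNumerics.PolyMP
open Literature.Analysis.ValidatedNumerics.ExpPoly

namespace Summit.Ventures.FusionMHD.Models

namespace RwmFRS1

namespace EqRes21

open Res21 (rs rs_pos rs_sq rs_lt_one fD)

/-! ### §1 The profile by name; `F`, `f` do not see the pressure, `g` does -/

/-- `F` of M_RWM,eq equals `F` of M_RWM (same fields). [instance data] -/
theorem kDotB_eq_P (r : ℝ) : Eq.Peq.kDotB 2 kk r = P.kDotB 2 kk r := by
  simp only [ScrewPinch.Profile.kDotB, Eq.Peq_Bθ, Eq.Peq_Bz, P_Bθ, P_Bz]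

/-- `F†` likewise. [instance data] -/
theorem kDotBDagger_eq_P (r : ℝ) : Eq.Peq.kDotBDagger 2 kk r = P.kDotBDagger 2 kk r := by
  simp only [ScrewPinch.Profile.kDotBDagger, Eq.Peq_Bθ, Eq.Peq_Bz, P_Bθ, P_Bz]

/-- Newcomb's `f` of M_RWM,eq IS that of M_RWM (as functions). [instance data] -/
theorem newcombF_eq_P : Eq.Peq.newcombF 2 kk = P.newcombF 2 kk := by
  funext r
  simp only [ScrewPinch.Profile.newcombF, kDotB_eq_P]

/-- Newcomb's `g` (11.90) of M_RWM,eq for `(m, k) = (2, −1/5)`, WITH the pressure term `2μ₀k²p′/k₀² = −4r³/(49(1+r²)³(r²+100))`: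
`g = (r(3−7r²)G(r²)(1+r²) − 100r³(r²+100)) / (1225(1+r²)³(r²+100)²)`, `G` = `Res21.G`. [cite: Freidberg2014, §11.5.1 eq. (11.90)] -/
theorem newcombG_eq {r : ℝ} (hr : r ≠ 0) :
    Eq.Peq.newcombG 2 kk r
      = (r * (3 - 7 * r ^ 2) * Res21.G (r ^ 2) * (1 + r ^ 2) - 100 * r ^ 3 * (r ^ 2 + 100))
          / (1225 * (1 + r ^ 2) ^ 3 * (r ^ 2 + 100) ^ 2) := by
  have h1 : (0 : ℝ) < 1 + r ^ 2 := by positivity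
  have h2 : (0 : ℝ) < r ^ 2 + 100 := by positivity
  rw [ScrewPinch.Profile.newcombG, Eq.deriv_p, kDotB_eq_P, kDotBDagger_eq_P, Res21.kDotB_eq hr,
    Res21.kDotBDagger_eq hr, Kq07.k0Sq_eq hr, Res21.G, kk, Eq.Peq_μ₀]
  field_simp
  ring

/-! ### §2 Rational bounds on `r_s = √(3/7)` -/

/-- `65465/100000 < r_s`. [instance data] -/
theorem rs_gt : ((13093 : ℝ) / 20000) < rs := by nlinarith [rs_pos, rs_sq]

/-- `r_s < 65466/100000`. [instance data] -/
theorem rs_lt : rs < ((32733 : ℝ) / 50000) := by nlinarith [rs_pos, rs_sq]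

/-! ### §3 The regular side: `w₁ = r` is a supersolution on `(0, 1/2]` although `p′ < 0` -/

/-- `g·r − f′ = r⁴(288800 − 699691r² + 1367r⁴ + 9807r⁶ + 49r⁸)/(1225(1+r²)³(r²+100)²)` (`f′ = Res21.fD`). [instance data] -/
theorem inner_identity {r : ℝ} (hr : r ≠ 0) :
    Eq.Peq.newcombG 2 kk r * r - fD r
      = r ^ 4 * (288800 - 699691 * r ^ 2 + 1367 * r ^ 4 + 9807 * r ^ 6 + 49 * r ^ 8)
          / (1225 * (1 + r ^ 2) ^ 3 * (r ^ 2 + 100) ^ 2) := by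
  have h1 : (0 : ℝ) < 1 + r ^ 2 := by positivity
  have h2 : (0 : ℝ) < r ^ 2 + 100 := by positivity
  rw [newcombG_eq hr, Res21.fD, Res21.G]
  field_simp
  ring

/-- `w₁ = r` is a supersolution on `(0, 1/2)`: `f′ ≤ g·r`. [instance data] -/
theorem fD_le {r : ℝ} (hr : r ∈ Ioo (0 : ℝ) (1 / 2)) : fD r ≤ Eq.Peq.newcombG 2 kk r * r := by
  have h := inner_identity hr.1.ne'
  have hr2 : r ^ 2 ≤ 1 / 4 := by nlinarith [hr.1, hr.2]
  have hN : 0 < 288800 - 699691 * r ^ 2 + 1367 * r ^ 4 + 9807 * r ^ 6 + 49 * r ^ 8 := by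
    nlinarith [pow_nonneg (sq_nonneg r) 2, pow_nonneg (sq_nonneg r) 3, pow_nonneg (sq_nonneg r) 4, sq_nonneg r]
  have : 0 ≤ r ^ 4 * (288800 - 699691 * r ^ 2 + 1367 * r ^ 4 + 9807 * r ^ 6 + 49 * r ^ 8)
      / (1225 * (1 + r ^ 2) ^ 3 * (r ^ 2 + 100) ^ 2) := by positivity
  linarith

/-- The supersolution equation for `w₁ = r` in M_RWM,eq: `(f·w₁′)′ = f′ = fD`. [instance data] -/
theorem hasDerivAt_fw {r : ℝ} (hr : 0 < r) :
    HasDerivAt (fun x => Eq.Peq.newcombF 2 kk x * deriv (fun y : ℝ => y) x) (fD r) r := by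
  rw [newcombF_eq_P]; exact Res21.hasDerivAt_fw hr

/-! ### §4 The factorisation `f = (r_s − r)²·φ` and `φ′` -/

/-- `φ = r³(r + r_s)²/((1+r²)²(r²+100))`. [instance data] -/
def phi (r : ℝ) : ℝ := r ^ 3 * (r + rs) ^ 2 / ((1 + r ^ 2) ^ 2 * (r ^ 2 + 100))

/-- `φ′` in closed form (numerator `N_φ(r, r_s)`, denominator `(1+r²)³(r²+100)²`). [instance data] -/
def dphi (r : ℝ) : ℝ :=
  (-r ^ 8 - 4 * r ^ 7 * rs - 3 * r ^ 6 * rs ^ 2 + 103 * r ^ 6 + 4 * r ^ 5 * rs - 99 * r ^ 4 * rs ^ 2 + 500 * r ^ 4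
      + 800 * r ^ 3 * rs + 300 * r ^ 2 * rs ^ 2) / ((1 + r ^ 2) ^ 3 * (r ^ 2 + 100) ^ 2)

/-- `3 − 7r² = 7(r_s² − r²)`. [instance data] -/
theorem three_sub (r : ℝ) : (3 : ℝ) - 7 * r ^ 2 = 7 * (rs ^ 2 - r ^ 2) := by rw [rs_sq]; ring

/-- `f = (r_s − r)²·φ` (`r ≠ 0`). [instance data] -/
theorem newcombF_fact {r : ℝ} (hr : r ≠ 0) : Eq.Peq.newcombF 2 kk r = (rs - r) ^ 2 * phi r := by
  have h1 : (0 : ℝ) < 1 + r ^ 2 := by positivity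
  have h2 : (0 : ℝ) < r ^ 2 + 100 := by positivity
  rw [newcombF_eq_P, Res21.newcombF_eq hr, three_sub, phi]
  field_simp
  ring

/-- `f = (r − r_s)²·φ` (`r ≠ 0`). [instance data] -/
theorem newcombF_factR {r : ℝ} (hr : r ≠ 0) : Eq.Peq.newcombF 2 kk r = (r - rs) ^ 2 * phi r := by
  rw [newcombF_fact hr]; ring

/-- `φ′ = dphi`. [instance data] -/
theorem hasDerivAt_phi (r : ℝ) : HasDerivAt phi (dphi r) r := by
  have e : phi = fun x : ℝ => (x ^ 5 + 2 * rs * x ^ 4 + rs ^ 2 * x ^ 3) / (x ^ 6 + 102 * x ^ 4 + 201 * x ^ 2 + 100) := by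
    funext x; unfold phi; congr 1 <;> ring
  rw [e]
  have hu : HasDerivAt (fun x : ℝ => x ^ 5 + 2 * rs * x ^ 4 + rs ^ 2 * x ^ 3)
      (5 * r ^ 4 + 2 * rs * (4 * r ^ 3) + rs ^ 2 * (3 * r ^ 2)) r := by
    have h5 := hasDerivAt_pow 5 r
    have h4 := (hasDerivAt_pow 4 r).const_mul (2 * rs)
    have h3 := (hasDerivAt_pow 3 r).const_mul (rs ^ 2)
    exact ((h5.add h4).add h3).congr_deriv (by push_cast; ring)
  have hv : HasDerivAt (fun x : ℝ => x ^ 6 + 102 * x ^ 4 + 201 * x ^ 2 + 100)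
      (6 * r ^ 5 + 102 * (4 * r ^ 3) + 201 * (2 * r)) r := by
    have h6 := hasDerivAt_pow 6 r
    have h4 := (hasDerivAt_pow 4 r).const_mul (102 : ℝ)
    have h2 := (hasDerivAt_pow 2 r).const_mul (201 : ℝ)
    exact (((h6.add h4).add h2).add_const (100 : ℝ)).congr_deriv (by push_cast; ring)
  have hvpos : (0 : ℝ) < r ^ 6 + 102 * r ^ 4 + 201 * r ^ 2 + 100 := by positivity
  have hq := hu.div hv hvpos.ne'
  refine hq.congr_deriv ?_
  have h1 : (0 : ℝ) < 1 + r ^ 2 := by positivity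
  have h2 : (0 : ℝ) < r ^ 2 + 100 := by positivity
  have hden : (r ^ 6 + 102 * r ^ 4 + 201 * r ^ 2 + 100) = (1 + r ^ 2) ^ 2 * (r ^ 2 + 100) := by ring
  unfold dphi
  rw [hden]
  field_simp
  ring

/-- `φ` is continuous. [instance data] -/
theorem continuous_phi : Continuous phi := by
  unfold phi
  exact Continuous.div (by fun_prop) (by fun_prop) fun x => by positivity

/-- `φ′` is continuous. [instance data] -/
theorem continuous_dphi : Continuous dphi := by
  unfold dphi
  exact Continuous.div (by fun_prop) (by fun_prop) fun x => by positivity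

/-- `φ > 0` for `r > 0`. [instance data] -/
theorem phi_pos {r : ℝ} (hr : 0 < r) : 0 < phi r := by
  unfold phi
  have : 0 < r + rs := by linarith [rs_pos]
  positivity

/-! ### §5 The η-brackets with `ν = −1/10`, `P ≡ 1` on both sides -/

/-- The left bracket `B = ν(ν+1)φ − ν(r_s − r)φ′` (template with `P ≡ 1`). [instance data] -/
theorem etaBracket_eq (r : ℝ) :
    etaBracket rs (-1 / 10) phi dphi (fun _ => (1 : ℝ)) (fun _ => (0 : ℝ)) (fun _ => (0 : ℝ)) r
      = -(9 / 100) * phi r + 1 / 10 * (rs - r) * dphi r := by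
  unfold etaBracket; ring

/-- The right bracket `B = ν(ν+1)φ + ν(r − r_s)φ′`. [instance data] -/
theorem etaBracketR_eq (r : ℝ) :
    etaBracketR rs (-1 / 10) phi dphi (fun _ => (1 : ℝ)) (fun _ => (0 : ℝ)) (fun _ => (0 : ℝ)) r
      = -(9 / 100) * phi r - 1 / 10 * (r - rs) * dphi r := by
  unfold etaBracketR; ring

/-- The common positive denominator `D = 1225(1+r²)³(r²+100)²`. [instance data] -/
def D (r : ℝ) : ℝ := 1225 * (1 + r ^ 2) ^ 3 * (r ^ 2 + 100) ^ 2

/-- `D > 0`. [instance data] -/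
theorem D_pos (r : ℝ) : 0 < D r := by unfold D; positivity

end EqRes21

end RwmFRS1

end Summit.Ventures.FusionMHD.Models

end
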